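/-
Copyright (c) 2026 the pub-hodgecm-mathlib formalisation cell (harness21).  Prover seat hodgecm-mathlib-LH4-p02 (g12): STAGE 1a «(D-RAM) FOUR-FRAME» road
(LEAD F0P3a-plan (g18) directive v1), tier-1 module `U4_Rows` §2 (iv-a)·T1 — dealer LH4-plan (g10) WORD #18 «`stub_U4_label_injOn` (classification)»; 2026-09-03.
-/
import Summits.HodgeConjecture.HodgeConjecture.Theorems.F0P3cDyRamFourFrameUnipotentLabelDefs   -- ★ DEFS №6 (p854734): `NormClassPlus`, `unipotentLabel`; brings ★ №3 `wMatrix`, `xPlus`, `dOfPlace`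
import Summits.HodgeConjecture.HodgeConjecture.Theorems.F0P3cDyRamWildPlaceDatum               -- ★ p854601 (this seat): `exists_isRamifiedQuadraticDatum_of_placesOver` (`σ_w ϖ ≠ ϖ` at a ramified place)
import Summits.HodgeConjecture.HodgeConjecture.Theorems.F0P3cDyRamProfilePiecesProps           -- ★ p854742 (B-p08 (g41)): `coe_mem_unitaryGroupOfForm_over` (`ψ(u) ∈ U(σ_w, J₀)`, cited not restated)
import Literature.NumberTheory.Rogawski1990.UnitaryThreeUnipotentStrataCM                        -- ★ `isConj_iff_exists_conj_localNonsplitEquiv`, `conj_localNonsplitEquiv_eq_one_iff`; brings ★ `conj_localNonsplitEquiv_sub_one_pow_eq_zero`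
import Literature.NumberTheory.Automorphic.UnitaryThreeRegularUnipotentClass                     -- ★ `exists_conj_coe_eq_regularUnipotentNormalForm` (Rogawski Prop. 3.9.1); brings ★ `exists_conj_coe_eq_cornerUnipotent_of_sq_eq_zero`, `exists_conj_eq_iff_exists_norm_mul`, `range_B₀_conj_sub_one_mulVec`
import Literature.NumberTheory.LocalFields.QuadraticLocalNormDichotomy                           -- ★ `IsCMField.exists_fixed_nonnorm_dichotomy'` (`[L⁺_vˣ : N L_wˣ] = 2` at EVERY non-split place, wild included)
import Literature.NumberTheory.Automorphic.UnitaryLatticeTreeDual                                -- ★ `pairing_antidiagonal` (`pairing σ J₀ = B₀ σ 3`)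
import HarnessLib

/-!
# Crux `H413`, line LH4 «(D-RAM) FOUR-FRAME», module `U4_Rows` §2 (iv-a)·T1: `unipotentLabel` is INJECTIVE on the unipotent classes of `U(Φ₃)(L⁺_v)` at every
# ramified `σ`-stable place — `{1, T₊, T₋, reg}` ([Rogawski1990] §3.9, Prop. 3.9.1; norm index two, wild included)

Cell `hodgecm-mathlib` (D-0151), FLOOR 0, crux item H413 = `stmt-HodgeConjecture-24833`, route of record `HCCMUnconditional`; squad F0∕P3c∕LH4 Track A; dealer
LH4-plan (g10) WORD #18; tier-1 module ★ `Cruxes/H413/Lines/F0_P3c_DyRamFourFrame_U4_Rows.lean` ED. 1 (b2ef357bfcbb4be0) §2.  THEOREMS ONLY (no `def`, no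
instance, no notation, no `sorry`, default heartbeats); lane `--supports stmt-HodgeConjecture-24833 --as helper`.

WHAT IS PROVED.  The head `unipotentLabel_injOn_of_placesOver` is the registered text of `stub_U4_label_injOn` VERBATIM.  With `X = wMatrix u − 1 = ψ(u) − 1`
(`ψ = localNonsplitEquiv : G ≃* U(σ_w, J₀)(L_w)`, ★ `coe_mem_unitaryGroupOfForm_over`): label `0` (`X = 0`) ⇒ `u = 1`
(★ `conj_localNonsplitEquiv_eq_one_iff`); label `3` (`X² ≠ 0`, `X` nilpotent by ★ `conj_localNonsplitEquiv_sub_one_pow_eq_zero`) ⇒ ONE regular class, both `ψ(u)`,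
`ψ(u′)` being `U(σ_w, J₀)`-conjugate to `u(1, −1∕2)` (★ `exists_conj_coe_eq_regularUnipotentNormalForm`, Prop. 3.9.1; `2 ≠ 0` in characteristic `0`); labels `1`∕`2`
(`X ≠ 0 = X²`): `ψ(u) ~ n(t)`, `t ∈ E⁰ ∖ 0` (★ `exists_conj_coe_eq_cornerUnipotent_of_sq_eq_zero`), the classes of the `n(t)` are the norm classes `t·N(L_wˣ)`
(★ `exists_conj_eq_iff_exists_norm_mul`), and — §2, the one computation here — `NormClassPlus σ_w ϖ d X ↔ t ∈ t₊·N(L_wˣ)`, `t₊ = (ϖ − σ_wϖ)∕N(ϖ)^{⌊d∕2⌋}` the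
coefficient of ★ `xPlus` (value set `{⟨y, Xy⟩} = t·N(L_w)`, ★ `range_B₀_conj_sub_one_mulVec`).  So label `1` twice ⇒ `t′ ∈ t·N`; label `2` twice ⇒ `t∕t₊`, `t′∕t₊`
are `σ_w`-fixed NON-norms, hence in the same coset of the index-two norm subgroup (★ `IsCMField.exists_fixed_nonnorm_dichotomy'`, EVERY non-split place) ⇒
`t′ ∈ t·N`; `t₊ ≠ 0` as `σ_w ϖ ≠ ϖ` at a ramified place (★ `exists_isRamifiedQuadraticDatum_of_placesOver`).  Conjugacy of `ψ(u), ψ(u′)` is conjugacy of `u, u′`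
(★ `isConj_iff_exists_conj_localNonsplitEquiv`), and `c = ⟦out c⟧`.  The stub's `¬ IsUnit 2` is carried, not used (the classification is uniform in the residue
characteristic).

HONEST LABEL.  Count-neutral helper (`--supports 24833`); it pays the U4 module's T1 row BY NAME only when the dealer pastes it.  (D-RAM) verdict of record PRINT
[LanglandsShelstad1989 Thm. p. 484 ∕ Rogawski1990 Prop. 4.9.1 (a)] ∕ XL; `HC_CM` is proved only modulo the 7 printed citations (2 remaining: hLiu418 =
`stmt-HodgeConjecture-24832`, h413 = `stmt-HodgeConjecture-24833`) until rung 0 closes.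

## References
* [Rogawski1990] J. D. Rogawski, *Automorphic Representations of Unitary Groups in Three Variables*, Ann. of Math. Stud. 123 (1990), §3.9 p. 32, Prop. 3.9.1.
* [LabesseLanglands1979] J.-P. Labesse, R. P. Langlands, *L-indistinguishability for SL(2)*, Canad. J. Math. 31 (1979), §2 (the norm classes `F^×∕N(E^×)`).
* [Serre1979] J.-P. Serre, *Local Fields*, GTM 67 (1979), Ch. XIV §3 (norm groups of quadratic extensions: index two).
-/

noncomputable section

namespace Summit.HodgeConjecture.HodgeConjecture.Cruxes.H413.F0P3cDyRamUnipotentLabelInjOn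

open NumberField IsDedekindDomain
open Literature.NumberTheory.Automorphic Literature.NumberTheory.Automorphic.UnitaryGroup
open Literature.NumberTheory.Automorphic.HermitianLattice Literature.NumberTheory.Automorphic.UnitaryThreeFourFrame
open Literature.NumberTheory.Rogawski1990 Literature.NumberTheory.GaloisRepresentations
open Summit.HodgeConjecture.HodgeConjecture.Cruxes.H413.F0P3cDyRamFourFramePieces
open Summit.HodgeConjecture.HodgeConjecture.Cruxes.H413.F0P3cDyRamFourFrameUnipotentLabelDefs
open Summit.HodgeConjecture.HodgeConjecture.Cruxes.H413.F0P3cDyRamWildPlaceDatum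
open Summit.HodgeConjecture.HodgeConjecture.Cruxes.H413.F0P3cDyRamProfilePiecesProps
open scoped Matrix MatrixGroups ValuativeRel

/-! ## §1 The `Fin 4` bookkeeping of the nested `if` of ★ `unipotentLabel` -/

section Label

variable {P₀ P₁ P₂ : Prop}

/-- The nested label is `0` iff the first test holds. -/
theorem label_eq_zero_iff {_ : Decidable P₀} {_ : Decidable P₁} {_ : Decidable P₂} :
    (if P₀ then (0 : Fin 4) else if P₁ then (if P₂ then 1 else 2) else 3) = 0 ↔ P₀ := by
  split_ifs <;> simp_all

/-- The nested label is `1` iff: not the first test, the second, and the third. -/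
theorem label_eq_one_iff {_ : Decidable P₀} {_ : Decidable P₁} {_ : Decidable P₂} :
    (if P₀ then (0 : Fin 4) else if P₁ then (if P₂ then 1 else 2) else 3) = 1 ↔ ¬ P₀ ∧ P₁ ∧ P₂ := by
  split_ifs <;> simp_all

/-- The nested label is `2` iff: not the first test, the second, not the third. -/
theorem label_eq_two_iff {_ : Decidable P₀} {_ : Decidable P₁} {_ : Decidable P₂} :
    (if P₀ then (0 : Fin 4) else if P₁ then (if P₂ then 1 else 2) else 3) = 2 ↔ ¬ P₀ ∧ P₁ ∧ ¬ P₂ := by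
  split_ifs <;> simp_all

/-- The nested label is `3` iff neither of the first two tests holds. -/
theorem label_eq_three_iff {_ : Decidable P₀} {_ : Decidable P₁} {_ : Decidable P₂} :
    (if P₀ then (0 : Fin 4) else if P₁ then (if P₂ then 1 else 2) else 3) = 3 ↔ ¬ P₀ ∧ ¬ P₁ := by
  split_ifs <;> simp_all

end Label

/-! ## §2 Field level: the invariant `NormClassPlus` of a conjugate of `n(t)` is the norm class `t ∈ t₊·N(K^×)` ([Rogawski1990] §3.9) -/

section Field

variable {K : Type*} [Field K] (σ : K →+* K)

/-- The pairing value of the reference nilpotent ★ `xPlus σ ϖ d = t₊·E₀₂`: `B₀(y, X₊·y) = t₊·σ(y₂)·y₂`, `t₊ = (ϖ − σϖ)·((ϖσϖ)^{⌊d∕2⌋})⁻¹`. [cite: Rogawski1990, §3.9 p. 32] -/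
theorem B₀_xPlus_mulVec (ϖ : K) (d : ℕ) (y : Fin 3 → K) :
    B₀ σ 3 y ((xPlus σ ϖ d).mulVec y) = (ϖ - σ ϖ) * ((ϖ * σ ϖ) ^ ((d - d % 2) / 2))⁻¹ * (σ (y 2) * y 2) := by
  rw [B₀_three_apply]
  simp [xPlus, Matrix.mulVec, dotProduct]
  ring

/-- **`NormClassPlus` OF A SINGULAR CLASS IS ITS NORM CLASS AGAINST `t₊`**: for `k ∈ U(σ, J₀)` and `n = n(t)`, `t ≠ 0`,
`NormClassPlus σ ϖ d (k n k⁻¹ − 1) ↔ ∃ m ≠ 0, t = t₊·(m·σm)` — the value set `{B₀(y, (knk⁻¹ − 1)y)}` is `t·N(K)` (★ `range_B₀_conj_sub_one_mulVec`) and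
`B₀(y′, X₊ y′)·(z σz) ∈ t₊·N(K)`. [cite: Rogawski1990, §3.9 p. 32] [cite: LabesseLanglands1979, §2] -/
theorem normClassPlus_conj_corner_iff (ϖ : K) (d : ℕ) {t : K} (ht : t ≠ 0) {n k : GL (Fin 3) K}
    (hn : (n : Matrix (Fin 3) (Fin 3) K) = !![1, 0, t; 0, 1, 0; 0, 0, 1]) (hk : k ∈ unitaryGroupOfForm σ ((StdForm.antidiagonal 3).over K)) :
    NormClassPlus σ ϖ d (((k * n * k⁻¹ : GL (Fin 3) K) : Matrix (Fin 3) (Fin 3) K) - 1) ↔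
      ∃ m : K, m ≠ 0 ∧ t = (ϖ - σ ϖ) * ((ϖ * σ ϖ) ^ ((d - d % 2) / 2))⁻¹ * (m * σ m) := by
  obtain ⟨tp, htp⟩ : ∃ tp : K, (ϖ - σ ϖ) * ((ϖ * σ ϖ) ^ ((d - d % 2) / 2))⁻¹ = tp := ⟨_, rfl⟩
  have hrange := range_B₀_conj_sub_one_mulVec σ hn hk
  unfold NormClassPlus
  simp only [UnitaryLatticeTree.pairing_antidiagonal, B₀_xPlus_mulVec, htp]
  constructor
  · rintro ⟨y, y', z, hne, heq⟩
    obtain ⟨a, ha⟩ : B₀ σ 3 y ((((k * n * k⁻¹ : GL (Fin 3) K) : Matrix (Fin 3) (Fin 3) K) - 1).mulVec y) ∈ Set.range (fun a : K => t * (σ a * a)) := by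
      rw [← hrange]; exact ⟨y, rfl⟩
    beta_reduce at ha
    rw [← ha] at hne heq
    have ha0 : a ≠ 0 := by
      rintro rfl
      exact hne (by rw [map_zero, zero_mul, mul_zero])
    have hσa : σ a ≠ 0 := (map_ne_zero σ).2 ha0
    have key : t = tp * ((y' 2 * z * a⁻¹) * σ (y' 2 * z * a⁻¹)) := by
      rw [map_mul, map_mul, map_inv₀]
      field_simp
      linear_combination heq
    refine ⟨y' 2 * z * a⁻¹, fun hm => ht ?_, key⟩
    rw [key, hm, zero_mul, mul_zero]
  · rintro ⟨m, hm, htm⟩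
    obtain ⟨y, hy⟩ : t * (σ 1 * 1) ∈ Set.range (fun x : Fin 3 → K => B₀ σ 3 x ((((k * n * k⁻¹ : GL (Fin 3) K) : Matrix (Fin 3) (Fin 3) K) - 1).mulVec x)) := by
      rw [hrange]; exact ⟨1, rfl⟩
    beta_reduce at hy
    refine ⟨y, Pi.single 2 1, m, ?_, ?_⟩
    · rw [hy, map_one, mul_one, mul_one]; exact ht
    · rw [hy, Pi.single_eq_same, map_one, mul_one, mul_one, mul_one]; exact htm

/-- Two elements of the class `t₊·N(K^×)` differ by a norm: `t = t₊ N(m)`, `t′ = t₊ N(m′)` ⇒ `t′ = N(m′∕m)·t`. [cite: LabesseLanglands1979, §2] -/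
theorem exists_norm_mul_of_plus_plus {tp t t' : K}
    (h : ∃ m : K, m ≠ 0 ∧ t = tp * (m * σ m)) (h' : ∃ m : K, m ≠ 0 ∧ t' = tp * (m * σ m)) :
    ∃ z : K, z ≠ 0 ∧ t' = z * σ z * t := by
  obtain ⟨m, hm, rfl⟩ := h
  obtain ⟨m', hm', rfl⟩ := h'
  have hσm : σ m ≠ 0 := (map_ne_zero σ).2 hm
  refine ⟨m' * m⁻¹, mul_ne_zero hm' (inv_ne_zero hm), ?_⟩
  rw [map_mul, map_inv₀]
  field_simp

/-- **THE OTHER CLASS IS ONE CLASS** (index two): given the dichotomy «every `σ`-fixed `s ≠ 0` is `N(z)` or `ε·N(z)`», two SKEW `t, t′ ≠ 0` which are NOT in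
`t₊·N(K^×)` (`t₊` skew, `≠ 0`) differ by a norm — `t∕t₊`, `t′∕t₊` are fixed non-norms, hence both in `ε·N`. [cite: Serre1979, Ch. XIV §3] [cite: LabesseLanglands1979, §2] -/
theorem exists_norm_mul_of_minus_minus {ε tp t t' : K}
    (hdich : ∀ s : K, s ≠ 0 → σ s = s → ∃ z : K, z ≠ 0 ∧ (s = z * σ z ∨ s = ε * (z * σ z)))
    (hσtp : σ tp = -tp) (htp : tp ≠ 0) (hσt : σ t = -t) (ht : t ≠ 0) (hσt' : σ t' = -t') (ht' : t' ≠ 0)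
    (h : ¬ ∃ m : K, m ≠ 0 ∧ t = tp * (m * σ m)) (h' : ¬ ∃ m : K, m ≠ 0 ∧ t' = tp * (m * σ m)) :
    ∃ z : K, z ≠ 0 ∧ t' = z * σ z * t := by
  have key : ∀ s : K, σ s = -s → s ≠ 0 → (¬ ∃ m : K, m ≠ 0 ∧ s = tp * (m * σ m)) → ∃ z : K, z ≠ 0 ∧ s = tp * (ε * (z * σ z)) := by
    intro s hσs hs hns
    have hfix : σ (s / tp) = s / tp := by rw [map_div₀, hσs, hσtp, neg_div_neg_eq]
    obtain ⟨z, hz, hz' | hz'⟩ := hdich (s / tp) (div_ne_zero hs htp) hfix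
    · exact absurd ⟨z, hz, by rw [← hz', mul_div_cancel₀ _ htp]⟩ hns
    · exact ⟨z, hz, by rw [← hz', mul_div_cancel₀ _ htp]⟩
  obtain ⟨z, hz, htz⟩ := key t hσt ht h
  obtain ⟨z', hz', htz'⟩ := key t' hσt' ht' h'
  have hσz : σ z ≠ 0 := (map_ne_zero σ).2 hz
  have hε : ε ≠ 0 := by
    rintro rfl
    exact ht (by rw [htz, zero_mul, mul_zero])
  refine ⟨z' * z⁻¹, mul_ne_zero hz' (inv_ne_zero hz), ?_⟩
  rw [htz, htz', map_mul, map_inv₀]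
  field_simp

end Field

/-! ## §3 The carrier `G = U(Φ₃)(L⁺_v)` at a `σ`-stable place: transport along `ψ = localNonsplitEquiv` (frame `T = 1`) -/

section CM

variable (L : Type) [Field L] [NumberField L] [IsCMField L] {v : HeightOneSpectrum (𝓞 ↥(maximalRealSubfield L))}
  (w : UnitaryGroup.PlacesOver L v) (hw : IsCMField.complexConj L • w.1 = w.1)

/-- Unipotency through `ψ`: `(u − 1)^n = 0` in `GL₃(L ⊗ L⁺_v)` gives `(wMatrix u − 1)^n = 0` (★ `conj_localNonsplitEquiv_sub_one_pow_eq_zero` at `T = 1`).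
[cite: Rogawski1990, §3.9 p. 32] -/
theorem wMatrix_sub_one_pow_eq_zero
    {u : ((UnitaryGroup.cmDatum L 3 (Matrix.of fun i j : Fin 3 => if i.val + j.val + 1 = 3 then (1 : L) else 0)).Local v)} {n : ℕ}
    (hu : (((u.val : GL (Fin 3) (UnitaryGroup.LocalRing L v)).val - 1) ^ n) = 0) :
    (wMatrix L w hw u - 1) ^ n = 0 := by
  unfold wMatrix
  simpa only [one_mul, inv_one, mul_one] using
    conj_localNonsplitEquiv_sub_one_pow_eq_zero L (Matrix.of fun i j : Fin 3 => if i.val + j.val + 1 = 3 then (1 : L) else 0) v w hw (T := 1) hu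

/-- `wMatrix u − 1 = 0 ⇒ u = 1` (`ψ` is injective, ★ `conj_localNonsplitEquiv_eq_one_iff`). [cite: Rogawski1990, §3.9 p. 32] -/
theorem eq_one_of_wMatrix_sub_one_eq_zero
    {u : ((UnitaryGroup.cmDatum L 3 (Matrix.of fun i j : Fin 3 => if i.val + j.val + 1 = 3 then (1 : L) else 0)).Local v)}
    (h : wMatrix L w hw u - 1 = 0) : u = 1 := by
  refine (conj_localNonsplitEquiv_eq_one_iff L w hw u).1 ?_
  rw [one_mul, inv_one, mul_one]
  exact Units.ext (sub_eq_zero.1 h)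

/-- Conjugacy through `ψ`: if `k₂·(k ψ(u) k⁻¹)·k₂⁻¹ = k′ ψ(u′) k′⁻¹` with `k, k′, k₂ ∈ U(σ_w, J₀)`, then `u ~ u′` in `G` (★ `isConj_iff_exists_conj_localNonsplitEquiv`).
[cite: Rogawski1990, §3.9 p. 32] -/
theorem isConj_of_conj_conj_eq
    {u u' : ((UnitaryGroup.cmDatum L 3 (Matrix.of fun i j : Fin 3 => if i.val + j.val + 1 = 3 then (1 : L) else 0)).Local v)}
    {k k' k₂ : GL (Fin 3) (w.1.adicCompletion L)}
    (hk : k ∈ unitaryGroupOfForm (galAdicCompletionMap (L := L) (IsCMField.complexConj L) hw) ((StdForm.antidiagonal 3).over (w.1.adicCompletion L)))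
    (hk' : k' ∈ unitaryGroupOfForm (galAdicCompletionMap (L := L) (IsCMField.complexConj L) hw) ((StdForm.antidiagonal 3).over (w.1.adicCompletion L)))
    (hk₂ : k₂ ∈ unitaryGroupOfForm (galAdicCompletionMap (L := L) (IsCMField.complexConj L) hw) ((StdForm.antidiagonal 3).over (w.1.adicCompletion L)))
    (h : k₂ * (k * ((localNonsplitEquiv (IsCMField.complexConj L) (Matrix.of fun i j : Fin 3 => if i.val + j.val + 1 = 3 then (1 : L) else 0) (IsCMField.complexConj_ne_one L) w hw u :
        ↥(unitaryGroupOfForm (galAdicCompletionMap (L := L) (IsCMField.complexConj L) hw) (placeForm (Matrix.of fun i j : Fin 3 => if i.val + j.val + 1 = 3 then (1 : L) else 0) w.1))) :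
          GL (Fin 3) (w.1.adicCompletion L)) * k⁻¹) * k₂⁻¹ =
      k' * ((localNonsplitEquiv (IsCMField.complexConj L) (Matrix.of fun i j : Fin 3 => if i.val + j.val + 1 = 3 then (1 : L) else 0) (IsCMField.complexConj_ne_one L) w hw u' :
        ↥(unitaryGroupOfForm (galAdicCompletionMap (L := L) (IsCMField.complexConj L) hw) (placeForm (Matrix.of fun i j : Fin 3 => if i.val + j.val + 1 = 3 then (1 : L) else 0) w.1))) :
          GL (Fin 3) (w.1.adicCompletion L)) * k'⁻¹) :
    IsConj u u' := by
  rw [isConj_iff_exists_conj_localNonsplitEquiv L w hw u u']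
  refine ⟨k'⁻¹ * k₂ * k, mul_mem (mul_mem (inv_mem hk') hk₂) hk, ?_⟩
  rw [one_mul, inv_one, mul_one, one_mul, mul_one]
  calc k'⁻¹ * k₂ * k * ((localNonsplitEquiv (IsCMField.complexConj L) (Matrix.of fun i j : Fin 3 => if i.val + j.val + 1 = 3 then (1 : L) else 0) (IsCMField.complexConj_ne_one L) w hw u :
        ↥(unitaryGroupOfForm (galAdicCompletionMap (L := L) (IsCMField.complexConj L) hw) (placeForm (Matrix.of fun i j : Fin 3 => if i.val + j.val + 1 = 3 then (1 : L) else 0) w.1))) :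
          GL (Fin 3) (w.1.adicCompletion L)) * (k'⁻¹ * k₂ * k)⁻¹
      = k'⁻¹ * (k₂ * (k * ((localNonsplitEquiv (IsCMField.complexConj L) (Matrix.of fun i j : Fin 3 => if i.val + j.val + 1 = 3 then (1 : L) else 0) (IsCMField.complexConj_ne_one L) w hw u :
        ↥(unitaryGroupOfForm (galAdicCompletionMap (L := L) (IsCMField.complexConj L) hw) (placeForm (Matrix.of fun i j : Fin 3 => if i.val + j.val + 1 = 3 then (1 : L) else 0) w.1))) :
          GL (Fin 3) (w.1.adicCompletion L)) * k⁻¹) * k₂⁻¹) * k' := by group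
    _ = _ := by rw [h]; group

/-- `σ_w` is an involution and `2 ≠ 0` in `L_w` (characteristic `0`). [cite: Rogawski1990, §3.9 p. 32] -/
theorem galAdicCompletionMap_involutive_and_two_ne_zero :
    (∀ x : w.1.adicCompletion L, galAdicCompletionMap (L := L) (IsCMField.complexConj L) hw (galAdicCompletionMap (L := L) (IsCMField.complexConj L) hw x) = x) ∧
      (2 : w.1.adicCompletion L) ≠ 0 := by
  refine ⟨fun x => galAdicCompletionMap_galAdicCompletionMap_of_smul_eq (IsCMField.complexConj L) w (IsCMField.complexConj_ne_one L) hw x, ?_⟩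
  rw [show (2 : w.1.adicCompletion L) = algebraMap L (w.1.adicCompletion L) 2 from (map_ofNat _ 2).symm]
  exact (map_ne_zero _).2 two_ne_zero

/-! ## §4 The three coincidences: regular ∕ class-`+` transvection ∕ class-`−` transvection -/

/-- **ONE REGULAR UNIPOTENT CLASS**: two unipotent `u, u′ ∈ G` with `(wMatrix − 1)² ≠ 0` are conjugate ([Rogawski1990] Prop. 3.9.1: both are `U(σ_w, J₀)`-conjugate
to `u(1, −1∕2)`). [cite: Rogawski1990, Proposition 3.9.1 p. 32] -/
theorem isConj_of_mul_self_ne_zero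
    {u u' : ((UnitaryGroup.cmDatum L 3 (Matrix.of fun i j : Fin 3 => if i.val + j.val + 1 = 3 then (1 : L) else 0)).Local v)}
    (hu : (((u.val : GL (Fin 3) (UnitaryGroup.LocalRing L v)).val - 1) ^ 3) = 0)
    (hu' : (((u'.val : GL (Fin 3) (UnitaryGroup.LocalRing L v)).val - 1) ^ 3) = 0)
    (hX : (wMatrix L w hw u - 1) * (wMatrix L w hw u - 1) ≠ 0) (hX' : (wMatrix L w hw u' - 1) * (wMatrix L w hw u' - 1) ≠ 0) :
    IsConj u u' := by
  obtain ⟨hσσ, h20⟩ := galAdicCompletionMap_involutive_and_two_ne_zero L w hw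
  obtain ⟨k, hk, hkN⟩ := exists_conj_coe_eq_regularUnipotentNormalForm (galAdicCompletionMap (L := L) (IsCMField.complexConj L) hw) hσσ h20
    (coe_mem_unitaryGroupOfForm_over L w hw u) ⟨3, wMatrix_sub_one_pow_eq_zero L w hw hu⟩ hX
  obtain ⟨k', hk', hkN'⟩ := exists_conj_coe_eq_regularUnipotentNormalForm (galAdicCompletionMap (L := L) (IsCMField.complexConj L) hw) hσσ h20
    (coe_mem_unitaryGroupOfForm_over L w hw u') ⟨3, wMatrix_sub_one_pow_eq_zero L w hw hu'⟩ hX'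
  refine isConj_of_conj_conj_eq L w hw hk hk' (one_mem _) ?_
  rw [one_mul, inv_one, mul_one]
  exact Units.ext (hkN.trans hkN'.symm)

/-- A transvection of `G` in corner form: if `(wMatrix u − 1)² = 0` and `wMatrix u − 1 ≠ 0` then `k ψ(u) k⁻¹ = n(t)` for some `k ∈ U(σ_w, J₀)` and some SKEW
`t ≠ 0`, and `wMatrix u − 1 = k⁻¹ (n(t)) k⁻¹⁻¹ − 1` on the nose. [cite: Rogawski1990, §3.9 p. 32] -/
theorem exists_conj_eq_corner_of_sq_eq_zero
    {u : ((UnitaryGroup.cmDatum L 3 (Matrix.of fun i j : Fin 3 => if i.val + j.val + 1 = 3 then (1 : L) else 0)).Local v)}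
    (h0 : wMatrix L w hw u - 1 ≠ 0) (hsq : (wMatrix L w hw u - 1) * (wMatrix L w hw u - 1) = 0) :
    ∃ k : GL (Fin 3) (w.1.adicCompletion L), k ∈ unitaryGroupOfForm (galAdicCompletionMap (L := L) (IsCMField.complexConj L) hw) ((StdForm.antidiagonal 3).over (w.1.adicCompletion L)) ∧
      ∃ t : w.1.adicCompletion L, galAdicCompletionMap (L := L) (IsCMField.complexConj L) hw t = -t ∧ t ≠ 0 ∧
        (((k * ((localNonsplitEquiv (IsCMField.complexConj L) (Matrix.of fun i j : Fin 3 => if i.val + j.val + 1 = 3 then (1 : L) else 0) (IsCMField.complexConj_ne_one L) w hw u :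
          ↥(unitaryGroupOfForm (galAdicCompletionMap (L := L) (IsCMField.complexConj L) hw) (placeForm (Matrix.of fun i j : Fin 3 => if i.val + j.val + 1 = 3 then (1 : L) else 0) w.1))) :
            GL (Fin 3) (w.1.adicCompletion L)) * k⁻¹ : GL (Fin 3) (w.1.adicCompletion L)) : Matrix (Fin 3) (Fin 3) (w.1.adicCompletion L)) = !![1, 0, t; 0, 1, 0; 0, 0, 1]) ∧
        wMatrix L w hw u - 1 = ((k⁻¹ * (k * ((localNonsplitEquiv (IsCMField.complexConj L) (Matrix.of fun i j : Fin 3 => if i.val + j.val + 1 = 3 then (1 : L) else 0) (IsCMField.complexConj_ne_one L) w hw u :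
          ↥(unitaryGroupOfForm (galAdicCompletionMap (L := L) (IsCMField.complexConj L) hw) (placeForm (Matrix.of fun i j : Fin 3 => if i.val + j.val + 1 = 3 then (1 : L) else 0) w.1))) :
            GL (Fin 3) (w.1.adicCompletion L)) * k⁻¹) * k⁻¹⁻¹ : GL (Fin 3) (w.1.adicCompletion L)) : Matrix (Fin 3) (Fin 3) (w.1.adicCompletion L)) - 1 := by
  obtain ⟨hσσ, -⟩ := galAdicCompletionMap_involutive_and_two_ne_zero L w hw
  obtain ⟨k, hk, t, hσt, hkn⟩ := exists_conj_coe_eq_cornerUnipotent_of_sq_eq_zero (galAdicCompletionMap (L := L) (IsCMField.complexConj L) hw) hσσ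
    (coe_mem_unitaryGroupOfForm_over L w hw u) hsq
  refine ⟨k, hk, t, eq_neg_of_add_eq_zero_left hσt, ?_, hkn, ?_⟩
  · rintro rfl
    apply h0
    have h1 : k * ((localNonsplitEquiv (IsCMField.complexConj L) (Matrix.of fun i j : Fin 3 => if i.val + j.val + 1 = 3 then (1 : L) else 0) (IsCMField.complexConj_ne_one L) w hw u :
          ↥(unitaryGroupOfForm (galAdicCompletionMap (L := L) (IsCMField.complexConj L) hw) (placeForm (Matrix.of fun i j : Fin 3 => if i.val + j.val + 1 = 3 then (1 : L) else 0) w.1))) :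
            GL (Fin 3) (w.1.adicCompletion L)) * k⁻¹ = 1 := by
      refine Units.ext ?_
      rw [hkn, Units.val_one]
      ext i j; fin_cases i <;> fin_cases j <;> simp
    have h2 := conj_eq_one_iff.1 h1
    show (((localNonsplitEquiv (IsCMField.complexConj L) (Matrix.of fun i j : Fin 3 => if i.val + j.val + 1 = 3 then (1 : L) else 0) (IsCMField.complexConj_ne_one L) w hw u :
          ↥(unitaryGroupOfForm (galAdicCompletionMap (L := L) (IsCMField.complexConj L) hw) (placeForm (Matrix.of fun i j : Fin 3 => if i.val + j.val + 1 = 3 then (1 : L) else 0) w.1))) :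
            GL (Fin 3) (w.1.adicCompletion L)) : Matrix (Fin 3) (Fin 3) (w.1.adicCompletion L)) - 1 = 0
    rw [h2, Units.val_one, sub_self]
  · show (((localNonsplitEquiv (IsCMField.complexConj L) (Matrix.of fun i j : Fin 3 => if i.val + j.val + 1 = 3 then (1 : L) else 0) (IsCMField.complexConj_ne_one L) w hw u :
          ↥(unitaryGroupOfForm (galAdicCompletionMap (L := L) (IsCMField.complexConj L) hw) (placeForm (Matrix.of fun i j : Fin 3 => if i.val + j.val + 1 = 3 then (1 : L) else 0) w.1))) :
            GL (Fin 3) (w.1.adicCompletion L)) : Matrix (Fin 3) (Fin 3) (w.1.adicCompletion L)) - 1 = _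
    congr 2
    group

/-- **CLASS `+` IS ONE CLASS**: two transvections of `G` (`X ≠ 0`, `X² = 0`) with `NormClassPlus` are conjugate (`t, t′ ∈ t₊·N` ⇒ `t′ ∈ t·N` ⇒ ★
`exists_conj_eq_iff_exists_norm_mul`). [cite: Rogawski1990, §3.9 p. 32] [cite: LabesseLanglands1979, §2] -/
theorem isConj_of_normClassPlus (ϖ : w.1.adicCompletion L) (d : ℕ)
    {u u' : ((UnitaryGroup.cmDatum L 3 (Matrix.of fun i j : Fin 3 => if i.val + j.val + 1 = 3 then (1 : L) else 0)).Local v)}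
    (h0 : wMatrix L w hw u - 1 ≠ 0) (hsq : (wMatrix L w hw u - 1) * (wMatrix L w hw u - 1) = 0)
    (hN : NormClassPlus (galAdicCompletionMap (L := L) (IsCMField.complexConj L) hw) ϖ d (wMatrix L w hw u - 1))
    (h0' : wMatrix L w hw u' - 1 ≠ 0) (hsq' : (wMatrix L w hw u' - 1) * (wMatrix L w hw u' - 1) = 0)
    (hN' : NormClassPlus (galAdicCompletionMap (L := L) (IsCMField.complexConj L) hw) ϖ d (wMatrix L w hw u' - 1)) :
    IsConj u u' := by
  obtain ⟨hσσ, -⟩ := galAdicCompletionMap_involutive_and_two_ne_zero L w hw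
  obtain ⟨k, hk, t, -, ht, hkn, hXu⟩ := exists_conj_eq_corner_of_sq_eq_zero L w hw h0 hsq
  obtain ⟨k', hk', t', -, ht', hkn', hXu'⟩ := exists_conj_eq_corner_of_sq_eq_zero L w hw h0' hsq'
  rw [hXu, normClassPlus_conj_corner_iff _ ϖ d ht hkn (inv_mem hk)] at hN
  rw [hXu', normClassPlus_conj_corner_iff _ ϖ d ht' hkn' (inv_mem hk')] at hN'
  obtain ⟨z, hz, hzt⟩ := exists_norm_mul_of_plus_plus (galAdicCompletionMap (L := L) (IsCMField.complexConj L) hw) hN hN'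
  obtain ⟨k₂, hk₂, hconj⟩ := (exists_conj_eq_iff_exists_norm_mul (galAdicCompletionMap (L := L) (IsCMField.complexConj L) hw) hσσ ht hkn hkn').2 ⟨z, hz, hzt⟩
  exact isConj_of_conj_conj_eq L w hw hk hk' hk₂ hconj

/-- **CLASS `−` IS ONE CLASS** (norm index two at a non-split place, wild included): two transvections of `G` (`X ≠ 0`, `X² = 0`) WITHOUT `NormClassPlus` are
conjugate, at a RAMIFIED `σ`-stable place with `ϖ` a uniformizer (`t₊ ≠ 0` because `σ_w ϖ ≠ ϖ`; `t∕t₊`, `t′∕t₊` are fixed non-norms, hence in the same coset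
of the index-two norm subgroup ★ `IsCMField.exists_fixed_nonnorm_dichotomy'`). [cite: Rogawski1990, §3.9 p. 32] [cite: Serre1979, Ch. XIV §3] -/
theorem isConj_of_not_normClassPlus (he : v.asIdeal.ramificationIdx' w.1.asIdeal ≠ 1) (ϖ : w.1.adicCompletion L) (hϖ : Valued.v ϖ = WithZero.exp (-1 : ℤ)) (d : ℕ)
    {u u' : ((UnitaryGroup.cmDatum L 3 (Matrix.of fun i j : Fin 3 => if i.val + j.val + 1 = 3 then (1 : L) else 0)).Local v)}
    (h0 : wMatrix L w hw u - 1 ≠ 0) (hsq : (wMatrix L w hw u - 1) * (wMatrix L w hw u - 1) = 0)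
    (hN : ¬ NormClassPlus (galAdicCompletionMap (L := L) (IsCMField.complexConj L) hw) ϖ d (wMatrix L w hw u - 1))
    (h0' : wMatrix L w hw u' - 1 ≠ 0) (hsq' : (wMatrix L w hw u' - 1) * (wMatrix L w hw u' - 1) = 0)
    (hN' : ¬ NormClassPlus (galAdicCompletionMap (L := L) (IsCMField.complexConj L) hw) ϖ d (wMatrix L w hw u' - 1)) :
    IsConj u u' := by
  obtain ⟨hσσ, -⟩ := galAdicCompletionMap_involutive_and_two_ne_zero L w hw
  obtain ⟨k, hk, t, hσt, ht, hkn, hXu⟩ := exists_conj_eq_corner_of_sq_eq_zero L w hw h0 hsq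
  obtain ⟨k', hk', t', hσt', ht', hkn', hXu'⟩ := exists_conj_eq_corner_of_sq_eq_zero L w hw h0' hsq'
  rw [hXu, normClassPlus_conj_corner_iff _ ϖ d ht hkn (inv_mem hk)] at hN
  rw [hXu', normClassPlus_conj_corner_iff _ ϖ d ht' hkn' (inv_mem hk')] at hN'
  have hϖ0 : ϖ ≠ 0 := by
    rintro rfl
    rw [map_zero] at hϖ
    exact WithZero.coe_ne_zero hϖ.symm
  obtain ⟨d₀, t₀, hD⟩ := exists_isRamifiedQuadraticDatum_of_placesOver L w hw he ϖ hϖ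
  have hsub : ϖ - galAdicCompletionMap (L := L) (IsCMField.complexConj L) hw ϖ ≠ 0 := by
    intro h
    have h' := hD.2.2.2.2.1
    rw [h, map_zero] at h'
    exact pow_ne_zero d₀ (by rw [hϖ]; exact WithZero.coe_ne_zero) h'.symm
  have hσϖ0 : galAdicCompletionMap (L := L) (IsCMField.complexConj L) hw ϖ ≠ 0 := (map_ne_zero _).2 hϖ0
  have htp0 : (ϖ - galAdicCompletionMap (L := L) (IsCMField.complexConj L) hw ϖ) *
      ((ϖ * galAdicCompletionMap (L := L) (IsCMField.complexConj L) hw ϖ) ^ ((d - d % 2) / 2))⁻¹ ≠ 0 :=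
    mul_ne_zero hsub (inv_ne_zero (pow_ne_zero _ (mul_ne_zero hϖ0 hσϖ0)))
  have hσtp : galAdicCompletionMap (L := L) (IsCMField.complexConj L) hw ((ϖ - galAdicCompletionMap (L := L) (IsCMField.complexConj L) hw ϖ) *
      ((ϖ * galAdicCompletionMap (L := L) (IsCMField.complexConj L) hw ϖ) ^ ((d - d % 2) / 2))⁻¹) =
      -((ϖ - galAdicCompletionMap (L := L) (IsCMField.complexConj L) hw ϖ) *
        ((ϖ * galAdicCompletionMap (L := L) (IsCMField.complexConj L) hw ϖ) ^ ((d - d % 2) / 2))⁻¹) := by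
    rw [map_mul, map_inv₀, map_pow, map_mul, map_sub, hσσ, mul_comm (galAdicCompletionMap (L := L) (IsCMField.complexConj L) hw ϖ) ϖ]
    ring
  obtain ⟨ε, -, -, -, hdich⟩ := Literature.NumberTheory.LocalFields.IsCMField.exists_fixed_nonnorm_dichotomy' L w hw
  obtain ⟨z, hz, hzt⟩ := exists_norm_mul_of_minus_minus (galAdicCompletionMap (L := L) (IsCMField.complexConj L) hw) hdich hσtp htp0 hσt ht hσt' ht' hN hN'
  obtain ⟨k₂, hk₂, hconj⟩ := (exists_conj_eq_iff_exists_norm_mul (galAdicCompletionMap (L := L) (IsCMField.complexConj L) hw) hσσ ht hkn hkn').2 ⟨z, hz, hzt⟩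
  exact isConj_of_conj_conj_eq L w hw hk hk' hk₂ hconj

end CM

/-! ## §5 The head: `stub_U4_label_injOn` of the U4 module, VERBATIM -/

/-- **(iv-a)·T1 CLASSIFICATION — `unipotentLabel` IS INJECTIVE ON UNIPOTENT CLASSES** (the registered text of `stub_U4_label_injOn` of ★
`Cruxes/H413/Lines/F0_P3c_DyRamFourFrame_U4_Rows.lean` §2, token for token): at a ramified `σ`-stable place `w ∣ v` of the CM field `L` (any residue characteristic;
`¬ IsUnit 2` is carried, not used), with `ϖ` a uniformizer of `L_w`, two conjugacy classes of `U(Φ₃)(L⁺_v)` with unipotent representatives and the same label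
coincide: `{1}` (label `0`), the class-`+` ∕ class-`−` transvections (labels `1`∕`2`, norm index two), the regular unipotent class (label `3`, Prop. 3.9.1).
[cite: Rogawski1990, §3.9 p. 32, Proposition 3.9.1] [cite: LabesseLanglands1979, §2] [cite: Serre1979, Ch. XIV §3] -/
theorem unipotentLabel_injOn_of_placesOver :
    ∀ (L : Type) [Field L] [NumberField L] [IsCMField L]
      {v : HeightOneSpectrum (𝓞 ↥(maximalRealSubfield L))} (w : UnitaryGroup.PlacesOver L v)
      (hw : IsCMField.complexConj L • w.1 = w.1) (_he : v.asIdeal.ramificationIdx' w.1.asIdeal ≠ 1)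
      (_h2 : ¬ IsUnit (2 : 𝒪[w.1.adicCompletion L]))
      (ϖ : (w.1.adicCompletion L)) (_hϖ : Valued.v ϖ = WithZero.exp (-1 : ℤ))
      (c c' : ConjClasses ((UnitaryGroup.cmDatum L 3 (Matrix.of fun i j : Fin 3 => if i.val + j.val + 1 = 3 then (1 : L) else 0)).Local v)),
      (((Quotient.out c : ((UnitaryGroup.cmDatum L 3 (Matrix.of fun i j : Fin 3 => if i.val + j.val + 1 = 3 then (1 : L) else 0)).Local v)).val : GL (Fin 3) (UnitaryGroup.LocalRing L v)).val - 1) ^ 3 = 0 →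
      (((Quotient.out c' : ((UnitaryGroup.cmDatum L 3 (Matrix.of fun i j : Fin 3 => if i.val + j.val + 1 = 3 then (1 : L) else 0)).Local v)).val : GL (Fin 3) (UnitaryGroup.LocalRing L v)).val - 1) ^ 3 = 0 →
      unipotentLabel L w hw ϖ c = unipotentLabel L w hw ϖ c' → c = c' := by
  intro L _ _ _ v w hw he _h2 ϖ hϖ c c' hc hc' hlab
  suffices hconj : IsConj (Quotient.out c : ((UnitaryGroup.cmDatum L 3 (Matrix.of fun i j : Fin 3 => if i.val + j.val + 1 = 3 then (1 : L) else 0)).Local v)) (Quotient.out c') by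
    rw [← Quotient.out_eq c, ← Quotient.out_eq c', ConjClasses.quotient_mk_eq_mk, ConjClasses.quotient_mk_eq_mk, ConjClasses.mk_eq_mk_iff_isConj]
    exact hconj
  unfold unipotentLabel at hlab
  by_cases h0 : wMatrix L w hw (Quotient.out c) - 1 = 0
  · -- label `0`: both representatives are `1`
    rw [if_pos h0] at hlab
    have h0' := label_eq_zero_iff.1 hlab.symm
    rw [eq_one_of_wMatrix_sub_one_eq_zero L w hw h0, eq_one_of_wMatrix_sub_one_eq_zero L w hw h0']
  rw [if_neg h0] at hlab
  by_cases hsq : (wMatrix L w hw (Quotient.out c) - 1) * (wMatrix L w hw (Quotient.out c) - 1) = 0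
  · rw [if_pos hsq] at hlab
    by_cases hN : NormClassPlus (galAdicCompletionMap (L := L) (IsCMField.complexConj L) hw) ϖ (dOfPlace L v w) (wMatrix L w hw (Quotient.out c) - 1)
    · -- label `1`: class-`+` transvections
      rw [if_pos hN] at hlab
      obtain ⟨h0', hsq', hN'⟩ := label_eq_one_iff.1 hlab.symm
      exact isConj_of_normClassPlus L w hw ϖ (dOfPlace L v w) h0 hsq hN h0' hsq' hN'
    · -- label `2`: class-`−` transvections
      rw [if_neg hN] at hlab
      obtain ⟨h0', hsq', hN'⟩ := label_eq_two_iff.1 hlab.symm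
      exact isConj_of_not_normClassPlus L w hw he ϖ hϖ (dOfPlace L v w) h0 hsq hN h0' hsq' hN'
  · -- label `3`: the regular unipotent class
    rw [if_neg hsq] at hlab
    obtain ⟨-, hsq'⟩ := label_eq_three_iff.1 hlab.symm
    exact isConj_of_mul_self_ne_zero L w hw hc hc' hsq hsq'

end Summit.HodgeConjecture.HodgeConjecture.Cruxes.H413.F0P3cDyRamUnipotentLabelInjOn

end
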